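import Literature.GroupTheory.LocallyConstantCochainTransport
import Literature.NumberTheory.GaloisRepresentations.TateLocalH2NonvanishingZMod
import Literature.NumberTheory.GaloisRepresentations.DecompositionGroupRelSlim
import Literature.NumberTheory.GaloisRepresentations.LocalFieldFiniteExtension
import Literature.NumberTheory.GaloisRepresentations.PadicAlgebraOfLocalField
import Literature.NumberTheory.Automorphic.AdicCompletionLocalField
import Literature.AnabelianGeometry.AbsoluteAnabelian.GaloisSubextensionProofs
import HarnessLib

/-!
# `D_𝔓 ∩ W` is the absolute Galois group of a local field; local-type cochains on it

Topic `NumberTheory/GaloisRepresentations`; namespace `Literature.NumberTheory.GaloisRepresentations`.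
Proof file: theorems only (no definition, no instance, no named fact).  Classical algebraic number
theory, written for the NUMBER-FIELD INSTANTIATION of the local-type axioms (AxLn), (AxD) of
abc-iut-w5-d055's abstract Neukirch theorem (`NeukirchAbstract*.lean`; [NSW] Prop. (12.1.9):
a closed subgroup of `Γ_K` of local type lies in a decomposition group; abc-iut GAP-LEDGER row
G-L4d2g4-1, campaign L).

SETTING.  `K` a number field, `Γ_K = Gal(K̄/K)` (`Field.absoluteGaloisGroup K`), `v` a finite place,
`K_v = v.adicCompletion K` (a non-archimedean local field, `AdicCompletionLocalField.lean`),
`𝔓 ∈ v.primesAbove` a prime of `\bar ℤ_K = absIntegers (𝓞 K) K` above `v`,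
`D_𝔓 = 𝔓.decompositionSubgroup Γ_K` (`= MulAction.stabilizer Γ_K 𝔓`), `W ≤ Γ_K` an open subgroup.

* `exists_continuousMulEquiv_absoluteGaloisGroup_decompositionSubgroup_inf` — **`D_𝔓 ∩ W ≅ Γ_E`**:
  there are `σ ∈ Γ_K` and a finite subextension `E ⊆ \bar K_v` of `K_v` with an isomorphism of
  TOPOLOGICAL groups `Γ_E ≃ₜ* D_𝔓 ∩ W`, such that the chosen embedding `ι : K̄ → \bar K_v`
  (`absClosureEmbedding`) maps `σ⁻¹ x` into `E` for every `x ∈ K̄` fixed by `W` (so `W ≤ Γ_{K(ζ)}`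
  gives `ζ_ℓ ∈ E`).  Ingredients (all in the tree): transitivity `𝔓 = σ 𝔓₀`
  (`exists_smul_eq_of_mem_primesAbove_holds`), `D_{𝔓₀} = res(Γ_{K_v})` (Neukirch *ANT* II (9.6),
  `decompositionSubgroup_adicCompletionPrime_eq_range`) with `res` injective
  (`absGaloisRestrict_adicCompletion_injective`), the open subgroup `U = res⁻¹(σ⁻¹ W σ) = Gal(\bar K_v/E)`
  (`exists_intermediateField_of_isOpen_absoluteGaloisGroup`, `nonempty_continuousMulEquiv_fixingSubgroup`),
  and `U ≃ₜ* φ(U)` for `φ = σ · res(·) · σ⁻¹` (`exists_continuousMulEquiv_subgroupMap`).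
* `exists_cocycleOn_not_coboundaryOn_decompositionSubgroup_inf` — **(AxLn)**: if `W` fixes a
  primitive `ℓ`-th root of unity `ζ ∈ K̄` (`ℓ` prime), there is a cochain `Γ_K → Γ_K → ZMod ℓ` which
  is locally constant and a `2`-cocycle on `D_𝔓 ∩ W` and is NOT a coboundary there of any cochain
  locally constant on `D_𝔓 ∩ W` — `H²(Γ_E, ℤ/ℓ) ≠ 0` for the local field `E ∋ ζ_ℓ`
  (`exists_twoCocycle_zmod_not_coboundary_of_isPrimitiveRoot`, Serre, Durham 1977 §6.5 (b))
  transported along `Γ_E ≅ D_𝔓 ∩ W` (`exists_cocycleOn_not_coboundaryOn`).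
* `cocycleOn_dim_le_one_decompositionSubgroup_inf` — **(AxD)**: under the same hypothesis, if `f` is
  such a non-cobounding cocycle on `D_𝔓 ∩ W`, every cochain `g` locally constant and a `2`-cocycle on
  `D_𝔓 ∩ W` is `c • f` plus a coboundary on `D_𝔓 ∩ W` (`c : ZMod ℓ`) — `|H²(Γ_E, μ_ℓ)| = ℓ`
  (`twoCocycle_zmod_dim_le_one_of_isPrimitiveRoot`, Serre *Local Fields* XIII §3).

The cochain conventions (total functions read on a subgroup, locally constant on `S × S`, cocycle /
coboundary identities quantified over `S`) are those of `LocallyConstantCocyclesClosedSubgroups.lean`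
and `NeukirchAbstractUniqueness.lean`.  HONEST FRAMING: classical; nothing here bears on
[IUTchIII] Cor. 3.12.

## References

* J. Neukirch, A. Schmidt, K. Wingberg, *Cohomology of Number Fields* (2nd ed. 2008), XII §1
  Prop. (12.1.9). [NeukirchSchmidtWingberg2008]
* J. Neukirch, *Algebraic Number Theory* (1999), Ch. II §9 (9.6). [NeukirchANT1999]
* J.-P. Serre, *Modular forms of weight one and Galois representations* (Durham 1977) §6.5 (b).
  [SerreDurham1977]
-/

noncomputable section

open scoped NumberField Pointwise
open Field IsDedekindDomain Function

namespace Literature.NumberTheory.GaloisRepresentations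

open Literature.GroupTheory.LocallyConstantCocycles
open Literature.AnabelianGeometry.AbsoluteAnabelian (exists_intermediateField_of_isOpen_absoluteGaloisGroup
  nonempty_continuousMulEquiv_fixingSubgroup)

variable (K : Type) [Field K] [NumberField K] (v : HeightOneSpectrum (𝓞 K))

/-! ### `D_𝔓 ∩ W ≅ Γ_E` for a finite extension `E` of `K_v` -/

/-- **`D_𝔓 ∩ W ≅ Gal(\bar E/E)` as topological groups.**  For a prime `𝔓 ∣ v` of `\bar ℤ_K` and an
open subgroup `W ≤ Γ_K` there are `σ ∈ Γ_K` and a finite subextension `E ⊆ \bar K_v` of the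
completion `K_v` such that `D_𝔓 ∩ W` is isomorphic, as a TOPOLOGICAL group, to the absolute Galois
group of `E`, and such that `ι(σ⁻¹ x) ∈ E` for every `x ∈ K̄` fixed pointwise by `W`
(`ι : K̄ → \bar K_v` the chosen embedding): `𝔓 = σ 𝔓₀`, `D_{𝔓₀} = res(Γ_{K_v})` (Neukirch *ANT* II
(9.6) `G_w(L|K) ≅ G(L_w|K_v)`), `E = (\bar K_v)^{U}` for the open subgroup
`U = res⁻¹(σ⁻¹ W σ) ≤ Γ_{K_v}`. [cite: NeukirchANT1999, Ch. II §9 Prop. (9.6)]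
[cite: NeukirchSchmidtWingberg2008, XII §1 (12.1.9)] -/
theorem exists_continuousMulEquiv_absoluteGaloisGroup_decompositionSubgroup_inf
    {𝔓 : Ideal (absIntegers (𝓞 K) K)} (h𝔓 : 𝔓 ∈ v.primesAbove)
    (W : Subgroup (absoluteGaloisGroup K)) (hW : IsOpen (W : Set (absoluteGaloisGroup K))) :
    ∃ (σ : absoluteGaloisGroup K)
      (E : IntermediateField (v.adicCompletion K) (AlgebraicClosure (v.adicCompletion K))),
      FiniteDimensional (v.adicCompletion K) E ∧
      (∀ x : AlgebraicClosure K, (∀ w ∈ W, w • x = x) →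
        absClosureEmbedding K (v.adicCompletion K) (σ⁻¹ • x) ∈ E) ∧
      Nonempty (absoluteGaloisGroup E ≃ₜ* ↥(𝔓.decompositionSubgroup (absoluteGaloisGroup K) ⊓ W)) := by
  haveI : CharZero (v.adicCompletion K) := LocalField.charZero_adicCompletion v
  -- `𝔓 = σ • 𝔓₀`
  obtain ⟨σ, hσ⟩ := HeightOneSpectrum.exists_smul_eq_of_mem_primesAbove_holds (K := K) (v := v)
    (adicCompletionPrime_mem_primesAbove K v) h𝔓
  -- the continuous injective homomorphism `φ = σ · res(−) · σ⁻¹ : Γ_{K_v} → Γ_K`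
  let φ : absoluteGaloisGroup (v.adicCompletion K) →* absoluteGaloisGroup K :=
    (MulAut.conj σ).toMonoidHom.comp (absGaloisRestrict K (v.adicCompletion K)).toMonoidHom
  have hφ_apply : ∀ u, φ u = σ * absGaloisRestrict K (v.adicCompletion K) u * σ⁻¹ := fun u => rfl
  have hφ_inj : Function.Injective φ := fun a b hab =>
    absGaloisRestrict_adicCompletion_injective K v ((MulAut.conj σ).injective hab)
  have hφ_cont : Continuous φ := by
    change Continuous fun x => σ * absGaloisRestrict K (v.adicCompletion K) x * σ⁻¹
    exact ((absGaloisRestrict K (v.adicCompletion K)).continuous.const_mul σ).mul_const σ⁻¹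
  -- its range is `D_𝔓 = σ D_{𝔓₀} σ⁻¹ = σ res(Γ_{K_v}) σ⁻¹`
  have hrange : φ.range = 𝔓.decompositionSubgroup (absoluteGaloisGroup K) := by
    rw [← hσ, Ideal.decompositionSubgroup_smul, decompositionSubgroup_adicCompletionPrime_eq_range K v]
    ext τ
    rw [MonoidHom.mem_range, Subgroup.mem_smul_pointwise_iff_exists]
    constructor
    · rintro ⟨x, rfl⟩
      exact ⟨absGaloisRestrict K (v.adicCompletion K) x, ⟨x, rfl⟩, rfl⟩
    · rintro ⟨y, ⟨x, rfl⟩, rfl⟩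
      exact ⟨x, rfl⟩
  -- the open subgroup `U = φ⁻¹(W)` of `Γ_{K_v}` and its image `φ(U) = D_𝔓 ∩ W`
  set U : Subgroup (absoluteGaloisGroup (v.adicCompletion K)) := W.comap φ with hU
  have hUopen : IsOpen (U : Set (absoluteGaloisGroup (v.adicCompletion K))) := hW.preimage hφ_cont
  have hUclosed : IsClosed (U : Set (absoluteGaloisGroup (v.adicCompletion K))) :=
    U.isClosed_of_isOpen hUopen
  have hmapU : U.map φ = 𝔓.decompositionSubgroup (absoluteGaloisGroup K) ⊓ W := by
    rw [hU, Subgroup.map_comap_eq, hrange]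
  -- `U = Gal(\bar K_v / E)` for a finite subextension `E`
  obtain ⟨E, hEfin, -, hEU⟩ :=
    exists_intermediateField_of_isOpen_absoluteGaloisGroup (v.adicCompletion K) U hUopen
  have hE₁ : Nonempty (↥U ≃ₜ* absoluteGaloisGroup E) := by
    rw [← hEU]
    exact nonempty_continuousMulEquiv_fixingSubgroup (v.adicCompletion K) E
  obtain ⟨e₁⟩ := hE₁
  -- `U ≃ₜ* φ(U) = D_𝔓 ∩ W`
  obtain ⟨e₂, -⟩ := exists_continuousMulEquiv_subgroupMap φ hφ_cont hφ_inj U hUclosed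
  refine ⟨σ, E, hEfin, fun x hx => ?_, ?_⟩
  · -- `ι(σ⁻¹ x)` is fixed by `U`, hence lies in `E = (\bar K_v)^U`
    rw [← InfiniteGalois.fixedField_fixingSubgroup E, IntermediateField.mem_fixedField_iff]
    intro f hf
    -- `f = toAlgEquiv u` with `u ∈ U`
    set u := (absoluteGaloisGroup.toAlgEquiv (v.adicCompletion K)).symm f with hu_def
    have hu : u ∈ U := by
      rw [← hEU, Subgroup.mem_comap]
      simpa [hu_def] using hf
    have hfu : f = absoluteGaloisGroup.toAlgEquiv (v.adicCompletion K) u := by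
      rw [hu_def, MulEquiv.apply_symm_apply]
    rw [hfu, ← absoluteGaloisGroup.smul_def, ← absGaloisRestrict_apply_smul]
    congr 1
    -- `res u • σ⁻¹ x = σ⁻¹ x` since `φ u = σ (res u) σ⁻¹ ∈ W` fixes `x`
    have hw : φ u ∈ W := Subgroup.mem_comap.mp hu
    have h1 : (σ * absGaloisRestrict K (v.adicCompletion K) u * σ⁻¹) • x = x := by
      rw [← hφ_apply]; exact hx _ hw
    calc absGaloisRestrict K (v.adicCompletion K) u • σ⁻¹ • x
        = σ⁻¹ • ((σ * absGaloisRestrict K (v.adicCompletion K) u * σ⁻¹) • x) := by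
          rw [mul_smul, mul_smul, inv_smul_smul]
      _ = σ⁻¹ • x := by rw [h1]
  · rw [← hmapU]
    exact ⟨e₁.symm.trans e₂⟩

/-! ### (AxLn): `H²(D_𝔓 ∩ W, ℤ/ℓ) ≠ 0` -/

/-- **(AxLn) A non-cobounding locally constant `2`-cocycle on `D_𝔓 ∩ W`.**  Let `ℓ` be a prime,
`ζ ∈ K̄` a primitive `ℓ`-th root of unity and `W ≤ Γ_K` an open subgroup fixing `ζ` (i.e.
`W ≤ Γ_{K(ζ)}`).  Then for every prime `𝔓 ∣ v` of `\bar ℤ_K` there is a cochain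
`f : Γ_K → Γ_K → ZMod ℓ` which is locally constant and a `2`-cocycle on `D_𝔓 ∩ W` and which is not
the coboundary on `D_𝔓 ∩ W` of any cochain locally constant on `D_𝔓 ∩ W`: `D_𝔓 ∩ W ≅ Γ_E` for a
finite extension `E ∋ ζ_ℓ` of `K_v` and `H²(Γ_E, ℤ/ℓ) ≠ 0` (Serre, Durham 1977 §6.5 (b);
`exists_twoCocycle_zmod_not_coboundary_of_isPrimitiveRoot`).  This is the local-type axiom
"`H²(G_𝔓 ∩ W, ℤ/ℓ) ≠ 0`" of Neukirch's characterisation of decomposition groups.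
[cite: NeukirchSchmidtWingberg2008, XII §1 (12.1.9)] [cite: SerreDurham1977, §6.5 (b)] -/
theorem exists_cocycleOn_not_coboundaryOn_decompositionSubgroup_inf
    {𝔓 : Ideal (absIntegers (𝓞 K) K)} (h𝔓 : 𝔓 ∈ v.primesAbove)
    {ℓ : ℕ} (hℓ : ℓ.Prime) {ζ : AlgebraicClosure K} (hζ : IsPrimitiveRoot ζ ℓ)
    (W : Subgroup (absoluteGaloisGroup K)) (hW : IsOpen (W : Set (absoluteGaloisGroup K)))
    (hWζ : ∀ w ∈ W, w • ζ = ζ) :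
    ∃ f : absoluteGaloisGroup K → absoluteGaloisGroup K → ZMod ℓ,
      IsLocallyConstant
          (fun x : ↥(𝔓.decompositionSubgroup (absoluteGaloisGroup K) ⊓ W) ×
            ↥(𝔓.decompositionSubgroup (absoluteGaloisGroup K) ⊓ W) => f x.1 x.2) ∧
      (∀ a ∈ 𝔓.decompositionSubgroup (absoluteGaloisGroup K) ⊓ W,
        ∀ b ∈ 𝔓.decompositionSubgroup (absoluteGaloisGroup K) ⊓ W,
        ∀ c ∈ 𝔓.decompositionSubgroup (absoluteGaloisGroup K) ⊓ W,
          f a b + f (a * b) c = f b c + f a (b * c)) ∧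
      ∀ β : absoluteGaloisGroup K → ZMod ℓ,
        IsLocallyConstant
            (fun s : ↥(𝔓.decompositionSubgroup (absoluteGaloisGroup K) ⊓ W) => β s) →
          ¬ ∀ a ∈ 𝔓.decompositionSubgroup (absoluteGaloisGroup K) ⊓ W,
              ∀ b ∈ 𝔓.decompositionSubgroup (absoluteGaloisGroup K) ⊓ W,
                f a b = β a + β b - β (a * b) := by
  haveI : CharZero (v.adicCompletion K) := LocalField.charZero_adicCompletion v
  obtain ⟨σ, E, hEfin, hEfix, ⟨e⟩⟩ :=
    exists_continuousMulEquiv_absoluteGaloisGroup_decompositionSubgroup_inf K v h𝔓 W hW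
  haveI := hEfin
  -- `E` is a non-archimedean local field of characteristic `0`
  letI := FiniteExtension.valuativeRel (v.adicCompletion K) E
  letI := FiniteExtension.topologicalSpace (v.adicCompletion K) E
  haveI : IsNonarchimedeanLocalField E :=
    FiniteExtension.isNonarchimedeanLocalField (v.adicCompletion K) E
  haveI : CharZero E :=
    charZero_of_injective_algebraMap (algebraMap (v.adicCompletion K) E).injective
  -- containing the primitive `ℓ`-th root of unity `ι(σ⁻¹ ζ)`
  have hmem : absClosureEmbedding K (v.adicCompletion K) (σ⁻¹ • ζ) ∈ E := hEfix ζ hWζ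
  have hζ₁ : IsPrimitiveRoot (σ⁻¹ • ζ) ℓ := by
    rw [absoluteGaloisGroup.smul_def]
    exact hζ.map_of_injective (absoluteGaloisGroup.toAlgEquiv K σ⁻¹).injective
  have hζ₂ : IsPrimitiveRoot (absClosureEmbedding K (v.adicCompletion K) (σ⁻¹ • ζ)) ℓ :=
    hζ₁.map_of_injective (absClosureEmbedding K (v.adicCompletion K)).toRingHom.injective
  have hζE : IsPrimitiveRoot (⟨_, hmem⟩ : E) ℓ :=
    IsPrimitiveRoot.of_map_of_injective
      (f := algebraMap E (AlgebraicClosure (v.adicCompletion K))) hζ₂ (algebraMap E _).injective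
  -- `H²(Γ_E, ℤ/ℓ) ≠ 0`, transported along `Γ_E ≃ₜ* D_𝔓 ∩ W`
  exact exists_cocycleOn_not_coboundaryOn _ e
    (exists_twoCocycle_zmod_not_coboundary_of_isPrimitiveRoot E hℓ hζE)

/-! ### (AxD): `dim H²(D_𝔓 ∩ W, ℤ/ℓ) ≤ 1` -/

/-- **(AxD) Local dimension `≤ 1` on `D_𝔓 ∩ W`.**  With `ℓ`, `ζ`, `W`, `𝔓` as in
`exists_cocycleOn_not_coboundaryOn_decompositionSubgroup_inf`: if `f` is a cochain locally constant
and a `2`-cocycle on `D_𝔓 ∩ W` which is not a coboundary there, then every such cochain `g` differs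
from `c • f` (`c : ZMod ℓ`) by the coboundary of a cochain locally constant on `D_𝔓 ∩ W` — since
`D_𝔓 ∩ W ≅ Γ_E` and `|H²(Γ_E, μ_ℓ)| = ℓ` (Serre, *Local Fields* XIII §3;
`twoCocycle_zmod_dim_le_one_of_isPrimitiveRoot`).  The local-type axiom "`dim H² ≤ 1`" of Neukirch's
characterisation of decomposition groups. [cite: NeukirchSchmidtWingberg2008, XII §1 (12.1.9)]
[cite: SerreLocalFields1979, XIII §3] -/
theorem cocycleOn_dim_le_one_decompositionSubgroup_inf
    {𝔓 : Ideal (absIntegers (𝓞 K) K)} (h𝔓 : 𝔓 ∈ v.primesAbove)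
    {ℓ : ℕ} (hℓ : ℓ.Prime) {ζ : AlgebraicClosure K} (hζ : IsPrimitiveRoot ζ ℓ)
    (W : Subgroup (absoluteGaloisGroup K)) (hW : IsOpen (W : Set (absoluteGaloisGroup K)))
    (hWζ : ∀ w ∈ W, w • ζ = ζ)
    (f g : absoluteGaloisGroup K → absoluteGaloisGroup K → ZMod ℓ)
    (hflc : IsLocallyConstant
      (fun x : ↥(𝔓.decompositionSubgroup (absoluteGaloisGroup K) ⊓ W) ×
        ↥(𝔓.decompositionSubgroup (absoluteGaloisGroup K) ⊓ W) => f x.1 x.2))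
    (hfcoc : ∀ a ∈ 𝔓.decompositionSubgroup (absoluteGaloisGroup K) ⊓ W,
      ∀ b ∈ 𝔓.decompositionSubgroup (absoluteGaloisGroup K) ⊓ W,
      ∀ c ∈ 𝔓.decompositionSubgroup (absoluteGaloisGroup K) ⊓ W,
        f a b + f (a * b) c = f b c + f a (b * c))
    (hglc : IsLocallyConstant
      (fun x : ↥(𝔓.decompositionSubgroup (absoluteGaloisGroup K) ⊓ W) ×
        ↥(𝔓.decompositionSubgroup (absoluteGaloisGroup K) ⊓ W) => g x.1 x.2))
    (hgcoc : ∀ a ∈ 𝔓.decompositionSubgroup (absoluteGaloisGroup K) ⊓ W,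
      ∀ b ∈ 𝔓.decompositionSubgroup (absoluteGaloisGroup K) ⊓ W,
      ∀ c ∈ 𝔓.decompositionSubgroup (absoluteGaloisGroup K) ⊓ W,
        g a b + g (a * b) c = g b c + g a (b * c))
    (hf : ∀ β : absoluteGaloisGroup K → ZMod ℓ,
      IsLocallyConstant (fun s : ↥(𝔓.decompositionSubgroup (absoluteGaloisGroup K) ⊓ W) => β s) →
        ¬ ∀ a ∈ 𝔓.decompositionSubgroup (absoluteGaloisGroup K) ⊓ W,
            ∀ b ∈ 𝔓.decompositionSubgroup (absoluteGaloisGroup K) ⊓ W,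
              f a b = β a + β b - β (a * b)) :
    ∃ (c : ZMod ℓ) (β : absoluteGaloisGroup K → ZMod ℓ),
      IsLocallyConstant (fun s : ↥(𝔓.decompositionSubgroup (absoluteGaloisGroup K) ⊓ W) => β s) ∧
      ∀ a ∈ 𝔓.decompositionSubgroup (absoluteGaloisGroup K) ⊓ W,
        ∀ b ∈ 𝔓.decompositionSubgroup (absoluteGaloisGroup K) ⊓ W,
          g a b - c * f a b = β a + β b - β (a * b) := by
  haveI : CharZero (v.adicCompletion K) := LocalField.charZero_adicCompletion v
  obtain ⟨σ, E, hEfin, hEfix, ⟨e⟩⟩ :=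
    exists_continuousMulEquiv_absoluteGaloisGroup_decompositionSubgroup_inf K v h𝔓 W hW
  haveI := hEfin
  letI := FiniteExtension.valuativeRel (v.adicCompletion K) E
  letI := FiniteExtension.topologicalSpace (v.adicCompletion K) E
  haveI : IsNonarchimedeanLocalField E :=
    FiniteExtension.isNonarchimedeanLocalField (v.adicCompletion K) E
  haveI : CharZero E :=
    charZero_of_injective_algebraMap (algebraMap (v.adicCompletion K) E).injective
  have hmem : absClosureEmbedding K (v.adicCompletion K) (σ⁻¹ • ζ) ∈ E := hEfix ζ hWζ
  have hζ₁ : IsPrimitiveRoot (σ⁻¹ • ζ) ℓ := by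
    rw [absoluteGaloisGroup.smul_def]
    exact hζ.map_of_injective (absoluteGaloisGroup.toAlgEquiv K σ⁻¹).injective
  have hζ₂ : IsPrimitiveRoot (absClosureEmbedding K (v.adicCompletion K) (σ⁻¹ • ζ)) ℓ :=
    hζ₁.map_of_injective (absClosureEmbedding K (v.adicCompletion K)).toRingHom.injective
  have hζE : IsPrimitiveRoot (⟨_, hmem⟩ : E) ℓ :=
    IsPrimitiveRoot.of_map_of_injective
      (f := algebraMap E (AlgebraicClosure (v.adicCompletion K))) hζ₂ (algebraMap E _).injective
  -- pull `f`, `g` back to `Γ_E`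
  set S := 𝔓.decompositionSubgroup (absoluteGaloisGroup K) ⊓ W with hS
  have hmul : ∀ a b : absoluteGaloisGroup E, ((e a : S) : absoluteGaloisGroup K) * (e b : S) =
      (e (a * b) : S) := fun a b => by rw [map_mul, Subgroup.coe_mul]
  have hcont : Continuous fun x : absoluteGaloisGroup E × absoluteGaloisGroup E => ((e x.1 : S), (e x.2 : S)) :=
    (e.continuous.comp continuous_fst).prodMk (e.continuous.comp continuous_snd)
  let df : absoluteGaloisGroup E → absoluteGaloisGroup E → ZMod ℓ := fun a b => f (e a) (e b)
  let dg : absoluteGaloisGroup E → absoluteGaloisGroup E → ZMod ℓ := fun a b => g (e a) (e b)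
  have hdflc : IsLocallyConstant (Function.uncurry df) := hflc.comp_continuous hcont
  have hdglc : IsLocallyConstant (Function.uncurry dg) := hglc.comp_continuous hcont
  have hdfcoc : ∀ a b c, df a b + df (a * b) c = df b c + df a (b * c) := fun a b c => by
    have := hfcoc _ (e a).2 _ (e b).2 _ (e c).2
    simp only [df]
    rw [← hmul, ← hmul]
    exact this
  have hdgcoc : ∀ a b c, dg a b + dg (a * b) c = dg b c + dg a (b * c) := fun a b c => by
    have := hgcoc _ (e a).2 _ (e b).2 _ (e c).2
    simp only [dg]
    rw [← hmul, ← hmul]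
    exact this
  -- `f` pulled back does not bound on `Γ_E`
  have hdf : ∀ β' : absoluteGaloisGroup E → ZMod ℓ, IsLocallyConstant β' →
      ¬ ∀ a b, df a b = β' a + β' b - β' (a * b) := by
    intro β' hβ' hcob
    obtain ⟨β, hβ, hfβ⟩ := coboundaryOn_of_coboundary S e (d := df) (f := f) (fun _ _ => rfl) hβ' hcob
    exact hf β hβ hfβ
  -- local dimension `≤ 1` on `Γ_E`, pushed forward
  obtain ⟨c, β', hβ', hdiff⟩ :=
    twoCocycle_zmod_dim_le_one_of_isPrimitiveRoot E hℓ hζE df dg hdflc hdfcoc hdglc hdgcoc hdf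
  obtain ⟨β, hβ, hgf⟩ := coboundaryOn_of_coboundary S e (d := fun a b => dg a b - c * df a b)
    (f := fun x y => g x y - c * f x y) (fun _ _ => rfl) hβ' hdiff
  exact ⟨c, β, hβ, hgf⟩

end Literature.NumberTheory.GaloisRepresentations

end
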